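import Summits.FinalStateConjecture.FinalStateConjecture.Theorems.SeamedChartsExhaust.Negative.KerrSchildTimeFunction

/-!
# The exact Schwarzschild model: parameters, charts, the `N = 1` decomposition
# (negative-side support for crux `stmt-FinalStateConjecture-13551`, route `StarvedNecks`; cycle 2, part 2/4)

For parameters `P : SchwModel.Params` (mass `M > 0`, inner radius `0 < r₀ ≤ 2M` of the ambient Kerr–Schild
patch `SchwModel.ST P = Kerr.spacetime M 0 r₀` — `r₀ = 2M`: the exterior only; `r₀ < 2M`:
horizon-penetrating —, anchoring radius `R₀ ≥ 100M`): the region `O = {r > 2M}`, flat tube radius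
`ρ(t) = R₀ + 1 + √t`, certified radius `Rc(s) = R₀ + 4 + √s`, flat coordinate domain
`U = {x⁰ > −1, r > ρ(x⁰)}` (it reaches slightly below `τ₀ = 0`, as ONE ATLAS (6) and clause (7) of `SEAMED`
at coordinate time exactly `τ₀` demand), the identity hole chart `Ψ` on the boosted exterior of the trivial
motion `(1, 0)`, the identity flat chart `Φ` on `U` (the identity Kerr chart `ΨK` restricted), and
`SchwModel.decomp P : FinalStateDecomposition (ST P) (O P) 2` with `N = 1`, `τ₀ = 0`: hole deviations
vanish identically (`deviation_Ψ`), the flat `C²` deviation tends to `0` by the tree's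
`Spacetime.tendsto_deviationCk_backgroundOn` (Kerr–Schild tail on `{r > ρ(τ)}`, `ρ → ∞`), `ρ(t)/t → 0`,
and the structure's covering clause holds by the static flow (`KerrSchildTimeFunction.lean`).

References: M. Dafermos, I. Rodnianski, *Lectures on black holes and linear waves*, arXiv:0811.0354, §5.1
(Schwarzschild/Kerr in ingoing Kerr–Schild coordinates, `∇t*` timelike); R. P. Kerr, A. Schild (1965), §3;
B. O'Neill, *Semi-Riemannian geometry*, Academic Press 1983, Ch. 14, pp. 402–403; M. Dafermos,
G. Holzegel, I. Rodnianski, M. Taylor, arXiv:2104.08222, §1.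
-/

noncomputable section

open TopologicalSpace Manifold Filter Topology Set Function
open scoped ContDiff Topology ENNReal Manifold

-- instance search through nested operator types `E4 →L E4 →L E4 →L ℝ` (as in the tree files)
set_option maxSynthPendingDepth 3

namespace Summit.FinalStateConjecture.FinalStateConjecture.Theorems.SeamedChartsExhaust.Negative

open Literature.Geometry.Lorentzian LorentzianMetric

/-! ### The model: parameters, spacetime, charts -/

namespace SchwModel

/-- `Kerr.Facts` is inhabited (all three fields are theorems in the tree: `Kerr.isConnected_region_holds`,
`Kerr.contMDiff_bilin_holds`, `Kerr.contMDiff_timeVector_holds`); scoped to this namespace. [folklore] -/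
scoped instance kerrFacts : Kerr.Facts :=
  ⟨Kerr.isConnected_region_holds, Kerr.contMDiff_bilin_holds, Kerr.contMDiff_timeVector_holds⟩

/-- Parameters of the exact Schwarzschild model: mass `M > 0`, inner radius `0 < r₀ ≤ 2M` of the
ambient Kerr–Schild patch (`r₀ = 2M`: the exterior only; `r₀ < 2M`: horizon-penetrating), and the
anchoring radius `R₀ ≥ 100 M` of the clause set. -/
structure Params where
  /-- mass -/
  M : ℝ
  /-- inner radius of the ambient patch -/
  r₀ : ℝ
  /-- anchoring radius `R₀` of `HonestCore`/`Seamed` -/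
  R₀ : ℝ
  /-- the mass is positive -/
  hM : 0 < M
  /-- the inner radius is positive -/
  hr₀ : 0 < r₀
  /-- the patch contains the exterior -/
  hr₂ : r₀ ≤ 2 * M
  /-- the anchoring radius is at least `100 M` (clause (a) of `HonestCore`) -/
  hR₀ : 100 * M ≤ R₀

variable (P : Params)

namespace Params

/-- `0 < 2M`. [folklore] -/
theorem two_M_pos : 0 < 2 * P.M := by linarith [P.hM]
/-- `2M < R₀`. [folklore] -/
theorem two_M_lt_R₀ : 2 * P.M < P.R₀ := by linarith [P.hM, P.hR₀]
/-- `0 < R₀`. [folklore] -/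
theorem R₀_pos : 0 < P.R₀ := by linarith [P.hM, P.hR₀]
/-- `r₊(M, 0) = 2M`. [folklore] -/
theorem rPlus_eq : Kerr.rPlus P.M 0 = 2 * P.M := Kerr.rPlus_zero_right P.hM.le
/-- `max r₀ 0 = r₀`. [folklore] -/
theorem max_r₀ : max P.r₀ 0 = P.r₀ := max_eq_left P.hr₀.le

end Params

/-- The ambient spacetime: the Schwarzschild Kerr–Schild patch `{r > r₀}`. -/
def ST : Spacetime.{0} 4 := Kerr.spacetime P.M 0 P.r₀ P.hM.le

/-- Flat tube radius `ρ(t) = R₀ + 1 + √t` (sublinear, `≥ R₀`). -/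
def ρ (t : ℝ) : ℝ := P.R₀ + 1 + √t

/-- Certified radius `R(s) = R₀ + 4 + √s` (monotone, continuous, `≥ R₀ + 4`, `≥ ρ + 3`). -/
def Rc (s : ℝ) : ℝ := P.R₀ + 4 + √s

/-- `ρ ≥ R₀ + 1`. [folklore] -/
theorem ρ_ge (t : ℝ) : P.R₀ + 1 ≤ ρ P t := le_add_of_nonneg_right (Real.sqrt_nonneg t)
/-- `Rc = ρ + 3`. [folklore] -/
theorem Rc_eq (s : ℝ) : Rc P s = ρ P s + 3 := by unfold Rc ρ; ring
/-- `ρ` is continuous. [folklore] -/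
theorem continuous_ρ : Continuous (ρ P) := continuous_const.add Real.continuous_sqrt
/-- `Rc` is continuous. [folklore] -/
theorem continuous_Rc : Continuous (Rc P) := continuous_const.add Real.continuous_sqrt
/-- `Rc` is monotone. [folklore] -/
theorem monotone_Rc : Monotone (Rc P) := fun _ _ h ↦ by
  unfold Rc; linarith [Real.sqrt_le_sqrt h]
/-- `ρ > 2M`: the flat domain lies in the exterior. [folklore] -/
theorem two_M_lt_ρ (t : ℝ) : 2 * P.M < ρ P t := by linarith [P.two_M_lt_R₀, ρ_ge P t]

/-- The flat coordinate domain `U = {x⁰ > −1, r > ρ(x⁰)}` (it reaches slightly below `τ₀ = 0`, as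
ONE ATLAS (6) and clause (7) at coordinate time exactly `τ₀` demand). -/
def U : Opens E4 :=
  ⟨{x | -1 < x 0 ∧ ρ P (x 0) < Kerr.radius 0 x},
    (isOpen_lt continuous_const (PiLp.continuous_apply 2 _ 0)).inter
      (isOpen_lt ((continuous_ρ P).comp (PiLp.continuous_apply 2 _ 0)) (Kerr.continuous_radius 0))⟩

/-- Membership in the flat coordinate domain `U`. [folklore] -/
theorem mem_U {x : E4} : x ∈ U P ↔ -1 < x 0 ∧ ρ P (x 0) < Kerr.radius 0 x := Iff.rfl

/-- The exterior lies in the patch (`r₀ ≤ 2M`). [folklore] -/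
theorem hext : (Kerr.background P.M 0).domain ≤ Kerr.region 0 P.r₀ := by
  change Kerr.region 0 (Kerr.rPlus P.M 0) ≤ Kerr.region 0 P.r₀
  rw [P.rPlus_eq]
  exact Kerr.region_mono 0 P.hr₂

/-- Membership in the Schwarzschild exterior: `r > 2M`. [folklore] -/
theorem mem_exterior_iff {x : E4} : x ∈ Kerr.exterior P.M 0 ↔ 2 * P.M < Kerr.radius 0 x := by
  rw [Kerr.mem_exterior, P.rPlus_eq, max_eq_left P.two_M_pos.le]

/-- Membership in the boosted exterior of the trivial motion: `r > 2M`. [folklore] -/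
theorem mem_bext_iff {x : E4} : x ∈ boostedKerrExterior 1 0 P.M 0 ↔ 2 * P.M < Kerr.radius 0 x := by
  rw [mem_boostedKerrExterior, poincareInv_one_zero, mem_exterior_iff]

/-- The boosted exterior of the trivial motion lies in the patch. [folklore] -/
theorem hbext : boostedKerrExterior 1 0 P.M 0 ≤ Kerr.region 0 P.r₀ := by
  rw [boostedKerrExterior_one_zero]
  exact hext P

/-- The flat domain lies in the exterior. [folklore] -/
theorem hUext : (Minkowski.backgroundOn (U P)).domain ≤ (Kerr.background P.M 0).domain := by
  intro x hx
  change x ∈ Kerr.exterior P.M 0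
  rw [mem_exterior_iff]
  exact (two_M_lt_ρ P (x 0)).trans hx.2

/-- The flat domain lies in the patch. [folklore] -/
theorem hUreg : U P ≤ Kerr.region 0 P.r₀ := fun _ hx ↦ hext P (hUext P hx)

/-- The identity Kerr chart `{r > 2M} ↪ {r > r₀}`. -/
def ΨK : (Kerr.background P.M 0).domain → (ST P).carrier := Opens.inclusion (hext P)

/-- The hole chart: the identity on the boosted exterior of the trivial motion `(1, 0)`. -/
def Ψ : (boostedKerrBackground 1 0 P.M 0).domain → (ST P).carrier := Opens.inclusion (hbext P)

/-- The flat chart: the identity Kerr chart restricted to `U`. -/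
def Φ : (Minkowski.backgroundOn (U P)).domain → (ST P).carrier := ΨK P ∘ Opens.inclusion (hUext P)

/-- The region: the Schwarzschild exterior `{r > 2M}` inside the patch. -/
def O : Set (ST P).carrier := {x | 2 * P.M < Kerr.radius 0 x.1}

/-- The hole chart is the identity on coordinates. [folklore] -/
@[simp] theorem Ψ_val (x : (boostedKerrBackground 1 0 P.M 0).domain) : (Ψ P x).1 = x.1 := rfl
/-- The Kerr chart is the identity on coordinates. [folklore] -/
@[simp] theorem ΨK_val (x : (Kerr.background P.M 0).domain) : (ΨK P x).1 = x.1 := rfl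
/-- The flat chart is the identity on coordinates. [folklore] -/
@[simp] theorem Φ_val (y : (Minkowski.backgroundOn (U P)).domain) : (Φ P y).1 = y.1 := rfl

/-- Membership in the region `O`: `r > 2M`. [folklore] -/
theorem mem_O {x : (ST P).carrier} : x ∈ O P ↔ 2 * P.M < Kerr.radius 0 x.1 := Iff.rfl

/-- The deviation of the identity hole chart from boosted Kerr `(1, 0)` vanishes identically. -/
theorem deviation_Ψ (x : (boostedKerrBackground 1 0 P.M 0).domain) :
    (ST P).deviation (boostedKerrBackground 1 0 P.M 0) (Ψ P) x = 0 := by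
  ext v w
  rw [Spacetime.deviation_apply]
  have e1 : mfderiv 𝓘(ℝ, E4) (𝓡 4) (Ψ P) x v = v := OpensChart.mfderiv_inclusion_apply (hbext P) x v
  have e2 : mfderiv 𝓘(ℝ, E4) (𝓡 4) (Ψ P) x w = w := OpensChart.mfderiv_inclusion_apply (hbext P) x w
  rw [e1, e2]
  change Kerr.bilin P.M 0 x.1 v w - boostedKerrBilin 1 0 P.M 0 x.1 v w = 0
  rw [boostedKerrBilin_one_zero]
  exact sub_self _

/-- The extended deviation of the hole chart vanishes. [folklore] -/
theorem deviationExtend_Ψ : (ST P).deviationExtend (boostedKerrBackground 1 0 P.M 0) (Ψ P) = 0 := by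
  funext z
  by_cases hz : z ∈ (boostedKerrBackground 1 0 P.M 0).domain
  · have := (ST P).deviationExtend_coe (boostedKerrBackground 1 0 P.M 0) (Ψ P) ⟨z, hz⟩
    rw [deviation_Ψ] at this
    exact this
  · exact (ST P).deviationExtend_of_not_mem _ _ hz

/-- The deviation of the identity Kerr chart from Kerr vanishes identically. -/
theorem deviation_ΨK (x : (Kerr.background P.M 0).domain) :
    (ST P).deviation (Kerr.background P.M 0) (ΨK P) x = 0 := by
  ext v w
  rw [Spacetime.deviation_apply]
  have e1 : mfderiv 𝓘(ℝ, E4) (𝓡 4) (ΨK P) x v = v := OpensChart.mfderiv_inclusion_apply (hext P) x v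
  have e2 : mfderiv 𝓘(ℝ, E4) (𝓡 4) (ΨK P) x w = w := OpensChart.mfderiv_inclusion_apply (hext P) x w
  rw [e1, e2]
  exact sub_self _

/-- The extended deviation of the Kerr chart vanishes. [folklore] -/
theorem deviationExtend_ΨK : (ST P).deviationExtend (Kerr.background P.M 0) (ΨK P) = 0 := by
  funext z
  by_cases hz : z ∈ (Kerr.background P.M 0).domain
  · have := (ST P).deviationExtend_coe (Kerr.background P.M 0) (ΨK P) ⟨z, hz⟩
    rw [deviation_ΨK] at this
    exact this
  · exact (ST P).deviationExtend_of_not_mem _ _ hz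

/-- Late-time chart property of an inclusion of open subsets of `E4` into the patch. -/
theorem isLateChart_inclusion (B : ModelBackground) (hV : B.domain ≤ Kerr.region 0 P.r₀)
    (htime : Continuous B.time)
    (hO : ∀ x : B.domain, 0 < B.time x.1 → 2 * P.M < Kerr.radius 0 x.1) :
    (ST P).IsLateChart B (O P) 0 (Opens.inclusion hV : B.domain → (ST P).carrier) := by
  refine ⟨contMDiff_inclusion (n := ∞) hV, ?_, ?_⟩
  · have hlate : IsOpen (B.lateRegion 0) :=
      isOpen_lt continuous_const (htime.comp continuous_subtype_val)
    have hg : IsOpenEmbedding (fun x : B.lateRegion 0 ↦ (x.1.1 : E4)) :=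
      B.domain.2.isOpenEmbedding_subtypeVal.comp hlate.isOpenEmbedding_subtypeVal
    have hcar : IsOpenEmbedding (Subtype.val : (ST P).carrier → E4) :=
      (Kerr.region 0 P.r₀).2.isOpenEmbedding_subtypeVal
    exact IsOpenEmbedding.of_comp _ hcar hg
  · rintro _ ⟨x, hx, rfl⟩
    exact hO x hx

/-- The identity Kerr chart is a late-time chart into `O`. [folklore] -/
theorem isLateChart_ΨK : (ST P).IsLateChart (Kerr.background P.M 0) (O P) 0 (ΨK P) :=
  isLateChart_inclusion P _ (hext P) (PiLp.continuous_apply 2 _ 0) fun x _ ↦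
    (mem_exterior_iff P).mp x.2

/-- The identity hole chart is a late-time chart into `O`. [folklore] -/
theorem isLateChart_Ψ : (ST P).IsLateChart (boostedKerrBackground 1 0 P.M 0) (O P) 0 (Ψ P) :=
  isLateChart_inclusion P _ (hbext P)
    ((PiLp.continuous_apply 2 _ 0).comp (continuous_poincareInv 1 0)) fun x _ ↦
    (mem_bext_iff P).mp x.2

/-- The identity flat chart is a late-time chart into `O`. [folklore] -/
theorem isLateChart_Φ : (ST P).IsLateChart (Minkowski.backgroundOn (U P)) (O P) 0 (Φ P) :=
  (ST P).isLateChart_backgroundOn_comp_inclusion (isLateChart_ΨK P) (hUext P)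

/-- The `Cᵏ` deviation of the Kerr chart is `0` on every slab. [folklore] -/
theorem deviationCk_ΨK (k : ℕ) (τ : ℝ) : (ST P).deviationCk (Kerr.background P.M 0) (ΨK P) k τ = 0 := by
  rw [Spacetime.deviationCk, deviationExtend_ΨK, supCkENorm_zero]

/-- The truncated `Cᵏ` deviation of the hole chart is `0`. [folklore] -/
theorem truncDeviationCk_Ψ (k : ℕ) (R τ : ℝ) :
    (ST P).truncDeviationCk (boostedKerrBackground 1 0 P.M 0) (Ψ P) k R τ = 0 := by
  rw [Spacetime.truncDeviationCk, deviationExtend_Ψ, supCkENorm_zero]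

/-- `ρ(t)/t → 0` (sublinear excision). [folklore] -/
theorem ρ_div_tendsto : Tendsto (fun t ↦ ρ P t / t) atTop (𝓝 0) := by
  have h1 : Tendsto (fun t : ℝ ↦ (P.R₀ + 1) / t) atTop (𝓝 0) :=
    tendsto_const_nhds.div_atTop tendsto_id
  have h2 : Tendsto (fun t : ℝ ↦ √t / t) atTop (𝓝 0) := by
    simp_rw [Real.sqrt_div_self]
    exact tendsto_inv_atTop_zero.comp Real.tendsto_sqrt_atTop
  have := h1.add h2
  simp only [add_zero] at this
  refine this.congr' ?_
  filter_upwards with t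
  simp only [ρ]
  ring

/-- `ρ → ∞`. [folklore] -/
theorem ρ_tendsto_atTop : Tendsto (ρ P) atTop atTop :=
  tendsto_atTop_add_const_left _ _ Real.tendsto_sqrt_atTop

/-- Vertical displacement inside the patch keeps the radius. -/
theorem mem_region_add_smul (x : (ST P).carrier) (s : ℝ) :
    x.1 + s • E4.basisVector 0 ∈ Kerr.region 0 P.r₀ := by
  show max P.r₀ 0 < Kerr.radius 0 (x.1 + s • E4.basisVector 0)
  rw [Kerr.radius_add_time_smul_basisVector]
  exact x.2

/-- The vertical translate `x + s ∂₀` as a point of the patch. -/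
def up (x : (ST P).carrier) (s : ℝ) : (ST P).carrier := ⟨x.1 + s • E4.basisVector 0, mem_region_add_smul P x s⟩

/-- Coordinates of the vertical translate. [folklore] -/
@[simp] theorem up_val (x : (ST P).carrier) (s : ℝ) : (up P x s).1 = x.1 + s • E4.basisVector 0 := rfl
/-- Time of the vertical translate. [folklore] -/
theorem up_zero_apply (x : (ST P).carrier) (s : ℝ) : (up P x s).1 0 = x.1 0 + s := by simp [up]
/-- Radius of the vertical translate. [folklore] -/
theorem radius_up (x : (ST P).carrier) (s : ℝ) : Kerr.radius 0 (up P x s).1 = Kerr.radius 0 x.1 :=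
  Kerr.radius_add_time_smul_basisVector 0 x.1 s

/-- The vertical translate by `s ≥ 0` of an exterior point lies in its causal future. [folklore] -/
theorem up_mem_causalFuture (x : (ST P).carrier) (hx : x ∈ O P) {s : ℝ} (hs : 0 ≤ s) :
    up P x s ∈ (ST P).metric.causalFuture (ST P).timeOrientation {x} :=
  Schw.vertical_mem_causalFuture (hM := P.hM.le) x hx hs _

/-- The vertical translate by `s > 0` of an exterior point lies in its chronological future. [folklore] -/
theorem up_mem_chronologicalFuture (x : (ST P).carrier) (hx : x ∈ O P) {s : ℝ} (hs : 0 < s) :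
    up P x s ∈ (ST P).metric.chronologicalFuture (ST P).timeOrientation {x} :=
  Schw.vertical_mem_chronologicalFuture (hM := P.hM.le) x hx hs _

/-- An exterior point lies in the causal past of its vertical translates. [folklore] -/
theorem mem_causalPast_up (x : (ST P).carrier) (hx : x ∈ O P) {s : ℝ} (hs : 0 ≤ s) :
    x ∈ (ST P).metric.causalPast (ST P).timeOrientation {up P x s} :=
  mem_causalPast_of_mem_causalFuture (up_mem_causalFuture P x hx hs)

/-- A point of the exterior with coordinate `y ∈ E4` is the hole-chart image of `y`. -/
theorem eq_Ψ (x : (ST P).carrier) (hx : x ∈ O P) :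
    ∃ hx' : x.1 ∈ (boostedKerrBackground 1 0 P.M 0).domain, Ψ P ⟨x.1, hx'⟩ = x :=
  ⟨(mem_bext_iff P).mpr hx, Subtype.ext rfl⟩

/-- The `N = 1` exact Schwarzschild decomposition of the exterior `O = {r > 2M}` of the patch
`{r > r₀}`: motion `(1, 0)`, identity hole chart, flat chart the identity on
`U = {x⁰ > −1, r > R₀ + 1 + √x⁰}`, `τ₀ = 0`. -/
def decomp : FinalStateDecomposition (ST P) (O P) 2 where
  N := 1
  mass _ := P.M
  spin _ := 0
  mass_pos _ := P.hM
  abs_spin_le_mass _ := by rw [abs_zero]; exact P.hM.le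
  motion _ := (1, 0)
  τ₀ := 0
  chart _ := Ψ P
  isLateChart _ := isLateChart_Ψ P
  tendsto_truncDeviationCk _ R := by
    simp_rw [truncDeviationCk_Ψ]
    exact tendsto_const_nhds
  exists_pairwise_disjoint _ := ⟨0, Subsingleton.pairwise⟩
  excision _ := ρ P
  tendsto_excision_div _ := ρ_div_tendsto P
  flatDomain := U P
  setOf_lt_excision_subset_flatDomain := by
    rintro x ⟨hx0, hx⟩
    have h := hx 0
    rw [poincareInv_one_zero] at h
    exact ⟨by linarith, h⟩
  flatChart := Φ P
  isLateChart_flat := isLateChart_Φ P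
  tendsto_deviationCk_flat := by
    refine (ST P).tendsto_deviationCk_backgroundOn (isLateChart_ΨK P).contMDiff ?_
      (ρ_tendsto_atTop P) (fun z (hz : z ∈ U P) ↦ hz.2) (hUext P)
    simp_rw [deviationCk_ΨK]
    exact tendsto_const_nhds
  diff_subset_causalPast := by
    rintro p ⟨hpO, hpn⟩
    -- `p⁰ ≤ 0`, otherwise `p` is hole-late charted
    have hp0 : p.1 0 ≤ 0 := by
      by_contra h
      push Not at h
      apply hpn
      refine Or.inl (mem_iUnion.mpr ⟨0, ?_⟩)
      obtain ⟨hp', hpeq⟩ := eq_Ψ P p hpO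
      refine ⟨⟨p.1, hp'⟩, ?_, hpeq⟩
      show 0 < poincareInv 1 0 p.1 0
      rwa [poincareInv_one_zero]
    -- flow up to time `0`, landing on the initial hole slab
    set s : ℝ := -p.1 0 with hs
    have hs0 : 0 ≤ s := by linarith
    refine causalFuture_mono (singleton_subset_iff.mpr ?_) (mem_causalPast_up P p hpO hs0)
    refine Or.inl (mem_iUnion.mpr ⟨(0 : Fin 1), ?_⟩)
    have hqO : up P p s ∈ O P := by rw [mem_O, radius_up]; exact hpO
    obtain ⟨hq', hqeq⟩ := eq_Ψ P (up P p s) hqO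
    refine ⟨⟨(up P p s).1, hq'⟩, ?_, hqeq⟩
    show poincareInv 1 0 (up P p s).1 0 = 0
    rw [poincareInv_one_zero, up_zero_apply, hs]
    ring



end SchwModel

end Summit.FinalStateConjecture.FinalStateConjecture.Theorems.SeamedChartsExhaust.Negative

end
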